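import Summits.BirchSwinnertonDyer.BirchSwinnertonDyer.Theorems.BiquadraticEisensteinDescentHeegnerTwistCouplingInSupplyLinnikCensusK
import Summits.BirchSwinnertonDyer.BirchSwinnertonDyer.Theorems.BiquadraticEisensteinDescentHeegnerTwistCouplingInSupplyLinnikCensusKOneInstances
import HarnessLib

set_option linter.dupNamespace false -- `Summit.BirchSwinnertonDyer.BirchSwinnertonDyer.Theorems.…` (summit = sub)
set_option autoImplicit false

/-!
# Crux `HeegnerTwistCouplingInSupply` (stmt-BirchSwinnertonDyer-21381) — the pattern-free census at `k = 2`: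
# scalar specialisation and the FIRST three-prime congruent families `E_{15p}`, `E_{21p}`, `E_{39p}` (`p ≡ 3 (8)`), `E_{35p}` (`p ≡ 7 (8)`)

Route `BiquadraticEisensteinDescent` (cell `pub/bsd-wall`, width seat `bsd-wall-cm-bed-w3` g20; `--supports` 21381, helper). Companion of
`…LinnikCensusK` (general-`k` census). New COVERAGE on the corner layer of crux 21381: the THREE-parameter congruent families (base
`p·r₁·r₂`), which w3 g19's k = 1 files could not reach («k = 2 would need g18's engine at k = 2»): here the engine is the general-`k`
pattern-free criterion, and each family is certified by ONE `decide` of `pfRecipeOdd`.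

* ★ `kTwo_allBut_two_of_BT` — `kAny_allBut_odd_of_BT` at `k = 2`, two slots, all data scalar (classes, symbol bits, cells as
  (class, bitmask), unit slot classes `κ₀, κ₁ (mod 8r₁r₂)`);
* `assemble_four` — the four sign patterns `((r₁/p), (r₂/p))` assembled into one census per `p`-class (`r₁, r₂` excepted);
* ★ `cruxConclusion_E15p_allBut_of_BT` — `W = E_{15p}`: for all but `O(log⁸ Q)` primes `p ≡ 3 (mod 8)` in `(√Q, Q]` the conclusion of
  crux 21381 holds (mod BT): families `(5/p) = +1`: cells `(3;+,+,+), (5;−,−,+)`, slots `19, 29 (mod 120)`; `(5/p) = −1`: cells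
  `(3;+,+,−), (5;−,−,−)`, slots `43, 53 (mod 120)` (found by the w3 g20 solver, `t = s*/2 + 1 = 2`);
* ★ `cruxConclusion_E21p_allBut_of_BT` — `W = E_{21p}`, `p ≡ 3 (mod 8)`: cells `(3;+,+,+), (5;−,−,−)`, slots `43, 5 (mod 168)` unless
  `((3/p),(7/p)) = (+1,−1)`, then `(3;+,−,+), (5;−,+,−)`, slots `11, 13 (mod 168)`;
* ★ `cruxConclusion_E35p_allBut_of_BT` (`p ≡ 7 (8)`, base `(p,5,7)`) and ★ `cruxConclusion_E39p_allBut_of_BT` (`p ≡ 3 (8)`, base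
  `(p,3,13)`) — same pattern, slots mod `280` / `312`.

HONEST FRAMING: RUNG-LEVEL, density one in `p` with a polylog exceptional set, two more congruent families; the crux as stated (all CM
`W`, all `p ≥ 5`; residual C⁺), its registered stubs and BSD are NOT touched; nothing is closed. THEOREMS ONLY.
-/

namespace Summit.BirchSwinnertonDyer.BirchSwinnertonDyer.Theorems.LinnikCensus

open Finset
open Literature.NumberTheory.EllipticCurves
open Summit.BirchSwinnertonDyer.BirchSwinnertonDyer.Theorems.SymbolicMonsky

/-! ## The `k = 2`, two-slot specialisation with scalar parameters (for instances) -/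

open scoped Classical in
/-- ★ **k = 2, two slots, odd base `W = E_{p r₁ r₂}`** — `kAny_allBut_odd_of_BT` with all data as scalars: base classes `pc, rc₁, rc₂`,
base symbols `a = [(r₁/p) = −1]`, `b = [(r₂/p) = −1]`, `r12 = [(r₂/r₁) = −1]`; cells `(c₀, m₀), (c₁, m₁)` (class index, bitmask
`bit 0 = [(q/p) = −1]`, `bit 1 = [(q/r₁) = −1]`, `bit 2 = [(q/r₂) = −1]`, bits `1, 2` also passed as Booleans `e…` for the slot
obligations); unit slot classes `κ₀, κ₁ (mod 8 r₁ r₂)`. The pattern-free check `hpf` is ONE `decide`. Modulo Burungale–Tian ONLY. [cite: BurungaleTian2026, Thm. 1.1] [cite: Montgomery1978, p. 561]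
[cite: MontgomeryVaughan2007, Cor. 11.17] -/
theorem kTwo_allBut_two_of_BT (hBT : burungaleTian_analyticRank_eq_zero_of_selmerCorank_eq_zero_of_hasCM)
    (pc rc₁ rc₂ : Fin 4) (r12 a b : Bool) (c₀ c₁ : Fin 4) (m₀ m₁ : ℕ)
    (hpf : pfRecipeOdd (⟨![pc, rc₁, rc₂], ![![false, a, b], ![false, false, r12], ![false, false, false]]⟩ : SymbData 3)
      [(c₀, m₀), (c₁, m₁)] = true)
    (hdist : c₀ ≠ c₁ ∨ m₀.testBit 0 ≠ m₁.testBit 0 ∨ m₀.testBit 1 ≠ m₁.testBit 1 ∨ m₀.testBit 2 ≠ m₁.testBit 2)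
    {r₁ r₂ : ℕ} (hr₁ : r₁.Prime) (hr₂ : r₂.Prime) (hne : r₁ ≠ r₂) (hr₁m : r₁ % 8 = clsVal rc₁) (hr₂m : r₂ % 8 = clsVal rc₂)
    (hr12 : jacobiSym (r₂ : ℤ) r₁ = -1 ↔ r12 = true)
    (κ₀ κ₁ : ℕ) (hκ₀u : IsUnit ((κ₀ : ℕ) : ZMod (8 * (r₁ * r₂)))) (hκ₁u : IsUnit ((κ₁ : ℕ) : ZMod (8 * (r₁ * r₂))))
    (hκ₀m : κ₀ % 8 = clsVal c₀) (hκ₁m : κ₁ % 8 = clsVal c₁)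
    (e₀₁ e₀₂ e₁₁ e₁₂ : Bool) (hb₀₁ : m₀.testBit 1 = e₀₁) (hb₀₂ : m₀.testBit 2 = e₀₂) (hb₁₁ : m₁.testBit 1 = e₁₁)
    (hb₁₂ : m₁.testBit 2 = e₁₂)
    (hκ₀e : ∀ q : ℕ, q.Prime → q % (8 * (r₁ * r₂)) = κ₀ % (8 * (r₁ * r₂)) →
      (jacobiSym (q : ℤ) r₁ = -1 ↔ e₀₁ = true) ∧ (jacobiSym (q : ℤ) r₂ = -1 ↔ e₀₂ = true))
    (hκ₁e : ∀ q : ℕ, q.Prime → q % (8 * (r₁ * r₂)) = κ₁ % (8 * (r₁ * r₂)) →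
      (jacobiSym (q : ℤ) r₁ = -1 ↔ e₁₁ = true) ∧ (jacobiSym (q : ℤ) r₂ = -1 ↔ e₁₂ = true)) :
    ∃ C : ℝ, 0 < C ∧ ∀ Q : ℕ, 3 ≤ Q → ∃ E : Finset ℕ, (E.card : ℝ) ≤ C * Real.log Q ^ 8 ∧
      ∀ p : ℕ, p.Prime → p % 8 = clsVal pc → (jacobiSym (r₁ : ℤ) p = -1 ↔ a = true) → (jacobiSym (r₂ : ℤ) p = -1 ↔ b = true) →
        Nat.sqrt Q < p → p ≤ Q → p ∉ E →
        ∃ (K : Type) (_ : Field K) (_ : NumberField K),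
          IsImaginaryQuadratic K ∧ 4 < (NumberField.discr K).natAbs ∧
          SatisfiesHeegnerHypothesis ((congruentNumberCurve (p * (r₁ * r₂))).conductorNorm ℤ) K ∧
          ((congruentNumberCurve (p * (r₁ * r₂))).quadraticTwist (NumberField.discr K : ℚ)).entireLFunction 1 ≠ 0 ∧
          ¬ p ∣ NumberField.classNumber K := by
  have hr : ∀ j : Fin 2, ((![r₁, r₂] : Fin 2 → ℕ) j).Prime := by
    intro j; fin_cases j
    · exact hr₁
    · exact hr₂
  have hrinj : Function.Injective (![r₁, r₂] : Fin 2 → ℕ) := by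
    intro i j h
    fin_cases i <;> fin_cases j
    · rfl
    · exact absurd h hne
    · exact absurd h.symm hne
    · rfl
  have hM : 8 * (r₁ * r₂) = 8 * ∏ j, (![r₁, r₂] : Fin 2 → ℕ) j := by simp [Fin.prod_univ_two]
  have hprod : ∀ p : ℕ, p * ∏ j, (![r₁, r₂] : Fin 2 → ℕ) j = p * (r₁ * r₂) := by
    intro p; simp [Fin.prod_univ_two]
  have hκ : ∀ i : Fin [(c₀, m₀), (c₁, m₁)].length, i = ⟨0, by simp⟩ ∨ i = ⟨1, by simp⟩ := by
    rintro ⟨i, hi⟩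
    have : i < 2 := by simpa using hi
    interval_cases i
    · left; rfl
    · right; rfl
  obtain ⟨C, hC, h⟩ := kAny_allBut_odd_of_BT hBT
    (⟨![pc, rc₁, rc₂], ![![false, a, b], ![false, false, r12], ![false, false, false]]⟩ : SymbData 3) [(c₀, m₀), (c₁, m₁)] hpf
    (by simp) (by
      intro i j hij
      rcases hκ i with rfl | rfl <;> rcases hκ j with rfl | rfl
      · exact absurd rfl hij
      · rcases hdist with h | h | h | h
        · exact Or.inl h
        · exact Or.inr ⟨0, h⟩
        · exact Or.inr ⟨1, h⟩
        · exact Or.inr ⟨2, h⟩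
      · rcases hdist with h | h | h | h
        · exact Or.inl fun hh => h hh.symm
        · exact Or.inr ⟨0, fun hh => h hh.symm⟩
        · exact Or.inr ⟨1, fun hh => h hh.symm⟩
        · exact Or.inr ⟨2, fun hh => h hh.symm⟩
      · exact absurd rfl hij)
    ![r₁, r₂] hr (by
      intro j; fin_cases j
      · simpa using hr₁m
      · simpa using hr₂m) hrinj (by
      intro i j hij
      fin_cases i <;> fin_cases j
      · exact absurd hij (lt_irrefl _)
      · simpa using hr12
      · exact absurd hij (by decide)
      · exact absurd hij (lt_irrefl _))
    hM (fun i => if i.val = 0 then κ₀ else κ₁) (by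
      intro i; rcases hκ i with rfl | rfl
      · simpa using hκ₀u
      · simpa using hκ₁u)
    (by
      intro i; rcases hκ i with rfl | rfl
      · simpa using hκ₀m
      · simpa using hκ₁m)
    (by
      intro i q hq hqκ j
      rcases hκ i with rfl | rfl
      · have hh := hκ₀e q hq (by simpa using hqκ)
        fin_cases j
        · have hh1 := hh.1; rw [← hb₀₁] at hh1; simpa using hh1
        · have hh2 := hh.2; rw [← hb₀₂] at hh2; simpa using hh2
      · have hh := hκ₁e q hq (by simpa using hqκ)
        fin_cases j
        · have hh1 := hh.1; rw [← hb₁₁] at hh1; simpa using hh1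
        · have hh2 := hh.2; rw [← hb₁₂] at hh2; simpa using hh2)
  refine ⟨C, hC, fun Q hQ => ?_⟩
  obtain ⟨E, hE, hp⟩ := h Q hQ
  refine ⟨E, hE, fun p hp' hp8 ha hb hyp hpQ hpE => ?_⟩
  rw [← hprod p]
  exact hp p hp' (by simpa using hp8) (by
    intro j; fin_cases j
    · simpa using ha
    · simpa using hb) hyp hpQ hpE


/-! ## Bookkeeping -/

/-- Reduction of a congruence modulo `M` to a divisor `d ∣ M`. [folklore] -/
theorem mod_eq_of_mod_eq_of_dvd {q κ M d : ℕ} (hd : d ∣ M) (h : q % M = κ % M) : q % d = κ % d := by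
  rw [← Nat.mod_mod_of_dvd q hd, h, Nat.mod_mod_of_dvd κ hd]

open scoped Classical in
/-- **Assembly of the four sub-configurations `([(r₁/p) = −1], [(r₂/p) = −1])`** of a three-prime base `(p, r₁, r₂)`: four censuses
(one per sign pattern) give one census for every prime `p` of the class, the primes `r₁, r₂` themselves being thrown into the
exceptional set. [folklore] -/
theorem assemble_four {R : ℕ → Prop} {r₁ r₂ pc8 : ℕ} (hr₁ : r₁.Prime) (hr₂ : r₂.Prime)
    (h : ∀ a b : Bool, ∃ C : ℝ, 0 < C ∧ ∀ Q : ℕ, 3 ≤ Q → ∃ E : Finset ℕ, (E.card : ℝ) ≤ C * Real.log Q ^ 8 ∧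
      ∀ p : ℕ, p.Prime → p % 8 = pc8 → (jacobiSym (r₁ : ℤ) p = -1 ↔ a = true) → (jacobiSym (r₂ : ℤ) p = -1 ↔ b = true) →
        Nat.sqrt Q < p → p ≤ Q → p ∉ E → R p) :
    ∃ C : ℝ, 0 < C ∧ ∀ Q : ℕ, 3 ≤ Q → ∃ E : Finset ℕ, (E.card : ℝ) ≤ C * Real.log Q ^ 8 ∧
      ∀ p : ℕ, p.Prime → p % 8 = pc8 → Nat.sqrt Q < p → p ≤ Q → p ∉ E → R p := by
  choose C hC hcfg using h
  have hlog8 : ∀ Q : ℕ, 3 ≤ Q → (1 : ℝ) ≤ Real.log Q ^ 8 := by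
    intro Q hQ3
    have hQ3' : (3 : ℝ) ≤ Q := by exact_mod_cast hQ3
    have he : Real.exp 1 ≤ (Q : ℝ) := le_trans (le_of_lt (lt_trans Real.exp_one_lt_d9 (by norm_num))) hQ3'
    rw [← Real.log_le_log_iff (Real.exp_pos 1) (by linarith), Real.log_exp] at he
    exact one_le_pow₀ he
  refine ⟨C false false + C false true + C true false + C true true + 2, by
    have := hC false false; have := hC false true; have := hC true false; have := hC true true; positivity, fun Q hQ => ?_⟩
  obtain ⟨E₁, hE₁, h₁⟩ := hcfg false false Q hQ
  obtain ⟨E₂, hE₂, h₂⟩ := hcfg false true Q hQ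
  obtain ⟨E₃, hE₃, h₃⟩ := hcfg true false Q hQ
  obtain ⟨E₄, hE₄, h₄⟩ := hcfg true true Q hQ
  refine ⟨E₁ ∪ E₂ ∪ E₃ ∪ E₄ ∪ {r₁, r₂}, ?_, ?_⟩
  · have h2 : (({r₁, r₂} : Finset ℕ).card : ℝ) ≤ 2 := by exact_mod_cast Finset.card_le_two
    have hu : ((E₁ ∪ E₂ ∪ E₃ ∪ E₄ ∪ {r₁, r₂}).card : ℝ) ≤ (E₁.card : ℝ) + E₂.card + E₃.card + E₄.card + 2 := by
      have a := Finset.card_union_le (E₁ ∪ E₂ ∪ E₃ ∪ E₄) {r₁, r₂}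
      have a' := Finset.card_union_le (E₁ ∪ E₂ ∪ E₃) E₄
      have b := Finset.card_union_le (E₁ ∪ E₂) E₃
      have c := Finset.card_union_le E₁ E₂
      have : ((E₁ ∪ E₂ ∪ E₃ ∪ E₄ ∪ {r₁, r₂}).card : ℝ) ≤
          (E₁.card : ℝ) + E₂.card + E₃.card + E₄.card + ({r₁, r₂} : Finset ℕ).card := by
        exact_mod_cast a.trans (Nat.add_le_add_right (a'.trans (Nat.add_le_add_right (b.trans (Nat.add_le_add_right c _)) _)) _)
      linarith
    have hl := hlog8 Q hQ
    calc ((E₁ ∪ E₂ ∪ E₃ ∪ E₄ ∪ {r₁, r₂}).card : ℝ) ≤ (E₁.card : ℝ) + E₂.card + E₃.card + E₄.card + 2 := hu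
      _ ≤ C false false * Real.log Q ^ 8 + C false true * Real.log Q ^ 8 + C true false * Real.log Q ^ 8 +
          C true true * Real.log Q ^ 8 + 2 * Real.log Q ^ 8 := by
            have := add_le_add (add_le_add (add_le_add hE₁ hE₂) hE₃) hE₄; linarith
      _ = (C false false + C false true + C true false + C true true + 2) * Real.log Q ^ 8 := by ring
  intro p hp hp8 hyp hpQ hpE
  simp only [Finset.mem_union, not_or, Finset.mem_insert, Finset.mem_singleton] at hpE
  obtain ⟨⟨⟨⟨hn₁, hn₂⟩, hn₃⟩, hn₄⟩, hne₁, hne₂⟩ := hpE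
  have hc₁ : Int.gcd (r₁ : ℤ) p = 1 := by
    rw [Int.gcd_natCast_natCast]; exact (Nat.coprime_primes hr₁ hp).mpr (fun h => hne₁ h.symm)
  have hc₂ : Int.gcd (r₂ : ℤ) p = 1 := by
    rw [Int.gcd_natCast_natCast]; exact (Nat.coprime_primes hr₂ hp).mpr (fun h => hne₂ h.symm)
  rcases jacobiSym.eq_one_or_neg_one hc₁ with h3 | h3 <;> rcases jacobiSym.eq_one_or_neg_one hc₂ with h5 | h5
  · exact h₁ p hp hp8 (by rw [h3]; simp) (by rw [h5]; simp) hyp hpQ hn₁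
  · exact h₂ p hp hp8 (by rw [h3]; simp) (by rw [h5]; simp) hyp hpQ hn₂
  · exact h₃ p hp hp8 (by rw [h3]; simp) (by rw [h5]; simp) hyp hpQ hn₃
  · exact h₄ p hp hp8 (by rw [h3]; simp) (by rw [h5]; simp) hyp hpQ hn₄

/-! ## `W = E_{15p}`, `p ≡ 3 (mod 8)` — the FIRST three-prime congruent families (k = 2) -/

open scoped Classical in
/-- ★ **`E_{15p}` (k = 2): the conclusion of crux 21381 for all but `O(log⁸ Q)` primes `p ≡ 3 (mod 8)`, modulo Burungale–Tian.**
Base `(p, 3, 5)`, `(5/3) = −1`; pattern-free families (criterion, ONE `decide` each; `t = s*/2 + 1 = 2`), depending only on `(5/p)`: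
`(5/p) = +1`: cells `(3 mod 8; (q/p) = (q/3) = (q/5) = +1)`, `(5 mod 8; (q/p) = (q/3) = −1, (q/5) = +1)`, slot classes `19, 29 (mod 120)`;
`(5/p) = −1`: cells `(3; +,+,−)`, `(5; −,−,−)`, slot classes `43, 53 (mod 120)`.
[cite: BurungaleTian2026, Thm. 1.1] [cite: Montgomery1978, p. 561] [cite: MontgomeryVaughan2007, Cor. 11.17] -/
theorem cruxConclusion_E15p_allBut_of_BT (hBT : burungaleTian_analyticRank_eq_zero_of_selmerCorank_eq_zero_of_hasCM) :
    ∃ C : ℝ, 0 < C ∧ ∀ Q : ℕ, 3 ≤ Q → ∃ E : Finset ℕ, (E.card : ℝ) ≤ C * Real.log Q ^ 8 ∧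
      ∀ p : ℕ, p.Prime → p % 8 = 3 → Nat.sqrt Q < p → p ≤ Q → p ∉ E →
        ∃ (K : Type) (_ : Field K) (_ : NumberField K),
          IsImaginaryQuadratic K ∧ 4 < (NumberField.discr K).natAbs ∧
          SatisfiesHeegnerHypothesis ((congruentNumberCurve (15 * p)).conductorNorm ℤ) K ∧
          ((congruentNumberCurve (15 * p)).quadraticTwist (NumberField.discr K : ℚ)).entireLFunction 1 ≠ 0 ∧
          ¬ p ∣ NumberField.classNumber K := by
  have e : ∀ p : ℕ, p * (3 * 5) = 15 * p := fun p => by ring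
  have u : ∀ n : ℕ, Nat.Coprime n 120 → IsUnit ((n : ℕ) : ZMod (8 * (3 * 5))) := fun n hn =>
    (ZMod.isUnit_iff_coprime n (8 * (3 * 5))).mpr hn
  have sl : ∀ {q κ : ℕ}, q % (8 * (3 * 5)) = κ % (8 * (3 * 5)) →
      jacobiSym (q : ℤ) 3 = jacobiSym ((κ % 3 : ℕ) : ℤ) 3 ∧ jacobiSym (q : ℤ) 5 = jacobiSym ((κ % 5 : ℕ) : ℤ) 5 :=
    fun hq => ⟨jacobiSym_three_of_mod (mod_eq_of_mod_eq_of_dvd (by norm_num) hq),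
      jacobiSym_five_of_mod (mod_eq_of_mod_eq_of_dvd (by norm_num) hq)⟩
  refine assemble_four (R := fun p => ∃ (K : Type) (_ : Field K) (_ : NumberField K),
      IsImaginaryQuadratic K ∧ 4 < (NumberField.discr K).natAbs ∧
      SatisfiesHeegnerHypothesis ((congruentNumberCurve (15 * p)).conductorNorm ℤ) K ∧
      ((congruentNumberCurve (15 * p)).quadraticTwist (NumberField.discr K : ℚ)).entireLFunction 1 ≠ 0 ∧
      ¬ p ∣ NumberField.classNumber K) Nat.prime_three Nat.prime_five fun a b => ?_
  simp only [← e]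
  cases b
  · -- `(5/p) = +1`
    refine kTwo_allBut_two_of_BT hBT 1 1 2 true a false 1 2 0 3 (by cases a <;> decide) (by decide)
      Nat.prime_three Nat.prime_five (by norm_num) rfl rfl (by norm_num) 19 29 (u 19 (by norm_num)) (u 29 (by norm_num))
      rfl rfl false false true false (by decide) (by decide) (by decide) (by decide) (fun q _ hq => ?_) (fun q _ hq => ?_)
    · obtain ⟨h3, h5⟩ := sl hq; rw [h3, h5]; norm_num
    · obtain ⟨h3, h5⟩ := sl hq; rw [h3, h5]; norm_num
  · -- `(5/p) = −1`
    refine kTwo_allBut_two_of_BT hBT 1 1 2 true a true 1 2 4 7 (by cases a <;> decide) (by decide)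
      Nat.prime_three Nat.prime_five (by norm_num) rfl rfl (by norm_num) 43 53 (u 43 (by norm_num)) (u 53 (by norm_num))
      rfl rfl false true true true (by decide) (by decide) (by decide) (by decide) (fun q _ hq => ?_) (fun q _ hq => ?_)
    · obtain ⟨h3, h5⟩ := sl hq; rw [h3, h5]; norm_num
    · obtain ⟨h3, h5⟩ := sl hq; rw [h3, h5]; norm_num

/-! ## `W = E_{21p}`, `p ≡ 3 (mod 8)` -/

open scoped Classical in
/-- ★ **`E_{21p}` (k = 2): the conclusion of crux 21381 for all but `O(log⁸ Q)` primes `p ≡ 3 (mod 8)`, modulo Burungale–Tian.**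
Base `(p, 3, 7)`, `(7/3) = +1`; families: `((3/p),(7/p)) ≠ (+1, −1)`: cells `(3; +,+,+)`, `(5; −,−,−)`, slots `43, 5 (mod 168)`;
`((3/p),(7/p)) = (+1, −1)`: cells `(3; +,−,+)`, `(5; −,+,−)`, slots `11, 13 (mod 168)`.
[cite: BurungaleTian2026, Thm. 1.1] [cite: Montgomery1978, p. 561] [cite: MontgomeryVaughan2007, Cor. 11.17] -/
theorem cruxConclusion_E21p_allBut_of_BT (hBT : burungaleTian_analyticRank_eq_zero_of_selmerCorank_eq_zero_of_hasCM) :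
    ∃ C : ℝ, 0 < C ∧ ∀ Q : ℕ, 3 ≤ Q → ∃ E : Finset ℕ, (E.card : ℝ) ≤ C * Real.log Q ^ 8 ∧
      ∀ p : ℕ, p.Prime → p % 8 = 3 → Nat.sqrt Q < p → p ≤ Q → p ∉ E →
        ∃ (K : Type) (_ : Field K) (_ : NumberField K),
          IsImaginaryQuadratic K ∧ 4 < (NumberField.discr K).natAbs ∧
          SatisfiesHeegnerHypothesis ((congruentNumberCurve (21 * p)).conductorNorm ℤ) K ∧
          ((congruentNumberCurve (21 * p)).quadraticTwist (NumberField.discr K : ℚ)).entireLFunction 1 ≠ 0 ∧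
          ¬ p ∣ NumberField.classNumber K := by
  have e : ∀ p : ℕ, p * (3 * 7) = 21 * p := fun p => by ring
  have u : ∀ n : ℕ, Nat.Coprime n 168 → IsUnit ((n : ℕ) : ZMod (8 * (3 * 7))) := fun n hn =>
    (ZMod.isUnit_iff_coprime n (8 * (3 * 7))).mpr hn
  have sl : ∀ {q κ : ℕ}, q % (8 * (3 * 7)) = κ % (8 * (3 * 7)) →
      jacobiSym (q : ℤ) 3 = jacobiSym ((κ % 3 : ℕ) : ℤ) 3 ∧ jacobiSym (q : ℤ) 7 = jacobiSym ((κ % 7 : ℕ) : ℤ) 7 :=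
    fun hq => ⟨jacobiSym_three_of_mod (mod_eq_of_mod_eq_of_dvd (by norm_num) hq),
      jacobiSym_seven_of_mod (mod_eq_of_mod_eq_of_dvd (by norm_num) hq)⟩
  have h7 : Nat.Prime 7 := by norm_num
  refine assemble_four (R := fun p => ∃ (K : Type) (_ : Field K) (_ : NumberField K),
      IsImaginaryQuadratic K ∧ 4 < (NumberField.discr K).natAbs ∧
      SatisfiesHeegnerHypothesis ((congruentNumberCurve (21 * p)).conductorNorm ℤ) K ∧
      ((congruentNumberCurve (21 * p)).quadraticTwist (NumberField.discr K : ℚ)).entireLFunction 1 ≠ 0 ∧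
      ¬ p ∣ NumberField.classNumber K) Nat.prime_three h7 fun a b => ?_
  simp only [← e]
  -- family 2 exactly for `(a, b) = (false, true)`, family 1 otherwise
  by_cases hab : a = false ∧ b = true
  · obtain ⟨rfl, rfl⟩ := hab
    refine kTwo_allBut_two_of_BT hBT 1 1 3 false false true 1 2 2 5 (by decide) (by decide)
      Nat.prime_three h7 (by norm_num) rfl rfl (by norm_num) 11 13 (u 11 (by norm_num)) (u 13 (by norm_num))
      rfl rfl true false false true (by decide) (by decide) (by decide) (by decide) (fun q _ hq => ?_) (fun q _ hq => ?_)
    · obtain ⟨h3, h7'⟩ := sl hq; rw [h3, h7']; norm_num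
    · obtain ⟨h3, h7'⟩ := sl hq; rw [h3, h7']; norm_num
  · have hpf : pfRecipeOdd (⟨![1, 1, 3], ![![false, a, b], ![false, false, false], ![false, false, false]]⟩ : SymbData 3)
        [(1, 0), (2, 7)] = true := by
      revert hab; cases a <;> cases b <;> decide
    refine kTwo_allBut_two_of_BT hBT 1 1 3 false a b 1 2 0 7 hpf (by decide)
      Nat.prime_three h7 (by norm_num) rfl rfl (by norm_num) 43 5 (u 43 (by norm_num)) (u 5 (by norm_num))
      rfl rfl false false true true (by decide) (by decide) (by decide) (by decide) (fun q _ hq => ?_) (fun q _ hq => ?_)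
    · obtain ⟨h3, h7'⟩ := sl hq; rw [h3, h7']; norm_num
    · obtain ⟨h3, h7'⟩ := sl hq; rw [h3, h7']; norm_num

/-! ## `W = E_{35p}`, `p ≡ 7 (mod 8)` -/

open scoped Classical in
/-- ★ **`E_{35p}` (k = 2): the conclusion of crux 21381 for all but `O(log⁸ Q)` primes `p ≡ 7 (mod 8)`, modulo Burungale–Tian.**
Base `(p, 5, 7)`, `(7/5) = −1`; families depend only on `(5/p)`: `(5/p) = +1`: cells `(3;+,+,+), (5;−,+,−)`, slots `11, 61 (mod 280)`;
`(5/p) = −1`: cells `(3;+,−,−), (5;−,−,+)`, slots `3, 37 (mod 280)`.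
[cite: BurungaleTian2026, Thm. 1.1] [cite: Montgomery1978, p. 561] [cite: MontgomeryVaughan2007, Cor. 11.17] -/
theorem cruxConclusion_E35p_allBut_of_BT (hBT : burungaleTian_analyticRank_eq_zero_of_selmerCorank_eq_zero_of_hasCM) :
    ∃ C : ℝ, 0 < C ∧ ∀ Q : ℕ, 3 ≤ Q → ∃ E : Finset ℕ, (E.card : ℝ) ≤ C * Real.log Q ^ 8 ∧
      ∀ p : ℕ, p.Prime → p % 8 = 7 → Nat.sqrt Q < p → p ≤ Q → p ∉ E →
        ∃ (K : Type) (_ : Field K) (_ : NumberField K),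
          IsImaginaryQuadratic K ∧ 4 < (NumberField.discr K).natAbs ∧
          SatisfiesHeegnerHypothesis ((congruentNumberCurve (35 * p)).conductorNorm ℤ) K ∧
          ((congruentNumberCurve (35 * p)).quadraticTwist (NumberField.discr K : ℚ)).entireLFunction 1 ≠ 0 ∧
          ¬ p ∣ NumberField.classNumber K := by
  have e : ∀ p : ℕ, p * (5 * 7) = 35 * p := fun p => by ring
  have u : ∀ n : ℕ, Nat.Coprime n 280 → IsUnit ((n : ℕ) : ZMod (8 * (5 * 7))) := fun n hn =>
    (ZMod.isUnit_iff_coprime n (8 * (5 * 7))).mpr hn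
  have sl : ∀ {q κ : ℕ}, q % (8 * (5 * 7)) = κ % (8 * (5 * 7)) →
      jacobiSym (q : ℤ) 5 = jacobiSym ((κ % 5 : ℕ) : ℤ) 5 ∧ jacobiSym (q : ℤ) 7 = jacobiSym ((κ % 7 : ℕ) : ℤ) 7 :=
    fun hq => ⟨jacobiSym_five_of_mod (mod_eq_of_mod_eq_of_dvd (by norm_num) hq),
      jacobiSym_seven_of_mod (mod_eq_of_mod_eq_of_dvd (by norm_num) hq)⟩
  have h7 : Nat.Prime 7 := by norm_num
  refine assemble_four (R := fun p => ∃ (K : Type) (_ : Field K) (_ : NumberField K),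
      IsImaginaryQuadratic K ∧ 4 < (NumberField.discr K).natAbs ∧
      SatisfiesHeegnerHypothesis ((congruentNumberCurve (35 * p)).conductorNorm ℤ) K ∧
      ((congruentNumberCurve (35 * p)).quadraticTwist (NumberField.discr K : ℚ)).entireLFunction 1 ≠ 0 ∧
      ¬ p ∣ NumberField.classNumber K) Nat.prime_five h7 fun a b => ?_
  simp only [← e]
  cases a
  · -- `(5/p) = +1`
    refine kTwo_allBut_two_of_BT hBT 3 2 3 true false b 1 2 0 5 (by cases b <;> decide) (by decide)
      Nat.prime_five h7 (by norm_num) rfl rfl (by norm_num) 11 61 (u 11 (by norm_num)) (u 61 (by norm_num))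
      rfl rfl false false false true (by decide) (by decide) (by decide) (by decide) (fun q _ hq => ?_) (fun q _ hq => ?_)
    · obtain ⟨h5, h7'⟩ := sl hq; rw [h5, h7']; norm_num
    · obtain ⟨h5, h7'⟩ := sl hq; rw [h5, h7']; norm_num
  · -- `(5/p) = −1`
    refine kTwo_allBut_two_of_BT hBT 3 2 3 true true b 1 2 6 3 (by cases b <;> decide) (by decide)
      Nat.prime_five h7 (by norm_num) rfl rfl (by norm_num) 3 37 (u 3 (by norm_num)) (u 37 (by norm_num))
      rfl rfl true true true false (by decide) (by decide) (by decide) (by decide) (fun q _ hq => ?_) (fun q _ hq => ?_)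
    · obtain ⟨h5, h7'⟩ := sl hq; rw [h5, h7']; norm_num
    · obtain ⟨h5, h7'⟩ := sl hq; rw [h5, h7']; norm_num

/-! ## `W = E_{39p}`, `p ≡ 3 (mod 8)` -/

open scoped Classical in
/-- ★ **`E_{39p}` (k = 2): the conclusion of crux 21381 for all but `O(log⁸ Q)` primes `p ≡ 3 (mod 8)`, modulo Burungale–Tian.**
Base `(p, 3, 13)`, `(13/3) = +1`; families depend only on `(13/p)`: `(13/p) = +1`: cells `(3;+,+,−), (5;−,−,−)`, slots `19, 5 (mod 312)`;
`(13/p) = −1`: cells `(3;+,+,+), (5;−,−,+)`, slots `43, 29 (mod 312)`.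
[cite: BurungaleTian2026, Thm. 1.1] [cite: Montgomery1978, p. 561] [cite: MontgomeryVaughan2007, Cor. 11.17] -/
theorem cruxConclusion_E39p_allBut_of_BT (hBT : burungaleTian_analyticRank_eq_zero_of_selmerCorank_eq_zero_of_hasCM) :
    ∃ C : ℝ, 0 < C ∧ ∀ Q : ℕ, 3 ≤ Q → ∃ E : Finset ℕ, (E.card : ℝ) ≤ C * Real.log Q ^ 8 ∧
      ∀ p : ℕ, p.Prime → p % 8 = 3 → Nat.sqrt Q < p → p ≤ Q → p ∉ E →
        ∃ (K : Type) (_ : Field K) (_ : NumberField K),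
          IsImaginaryQuadratic K ∧ 4 < (NumberField.discr K).natAbs ∧
          SatisfiesHeegnerHypothesis ((congruentNumberCurve (39 * p)).conductorNorm ℤ) K ∧
          ((congruentNumberCurve (39 * p)).quadraticTwist (NumberField.discr K : ℚ)).entireLFunction 1 ≠ 0 ∧
          ¬ p ∣ NumberField.classNumber K := by
  have e : ∀ p : ℕ, p * (3 * 13) = 39 * p := fun p => by ring
  have u : ∀ n : ℕ, Nat.Coprime n 312 → IsUnit ((n : ℕ) : ZMod (8 * (3 * 13))) := fun n hn =>
    (ZMod.isUnit_iff_coprime n (8 * (3 * 13))).mpr hn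
  have sl : ∀ {q κ : ℕ}, q % (8 * (3 * 13)) = κ % (8 * (3 * 13)) →
      jacobiSym (q : ℤ) 3 = jacobiSym ((κ % 3 : ℕ) : ℤ) 3 ∧ jacobiSym (q : ℤ) 13 = jacobiSym ((κ % 13 : ℕ) : ℤ) 13 :=
    fun hq => ⟨jacobiSym_three_of_mod (mod_eq_of_mod_eq_of_dvd (by norm_num) hq),
      jacobiSym_thirteen_of_mod (mod_eq_of_mod_eq_of_dvd (by norm_num) hq)⟩
  have h13 : Nat.Prime 13 := by norm_num
  refine assemble_four (R := fun p => ∃ (K : Type) (_ : Field K) (_ : NumberField K),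
      IsImaginaryQuadratic K ∧ 4 < (NumberField.discr K).natAbs ∧
      SatisfiesHeegnerHypothesis ((congruentNumberCurve (39 * p)).conductorNorm ℤ) K ∧
      ((congruentNumberCurve (39 * p)).quadraticTwist (NumberField.discr K : ℚ)).entireLFunction 1 ≠ 0 ∧
      ¬ p ∣ NumberField.classNumber K) Nat.prime_three h13 fun a b => ?_
  simp only [← e]
  cases b
  · -- `(13/p) = +1`
    refine kTwo_allBut_two_of_BT hBT 1 1 2 false a false 1 2 4 7 (by cases a <;> decide) (by decide)
      Nat.prime_three h13 (by norm_num) rfl rfl (by norm_num) 19 5 (u 19 (by norm_num)) (u 5 (by norm_num))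
      rfl rfl false true true true (by decide) (by decide) (by decide) (by decide) (fun q _ hq => ?_) (fun q _ hq => ?_)
    · obtain ⟨h3, h13'⟩ := sl hq; rw [h3, h13']; norm_num
    · obtain ⟨h3, h13'⟩ := sl hq; rw [h3, h13']; norm_num
  · -- `(13/p) = −1`
    refine kTwo_allBut_two_of_BT hBT 1 1 2 false a true 1 2 0 3 (by cases a <;> decide) (by decide)
      Nat.prime_three h13 (by norm_num) rfl rfl (by norm_num) 43 29 (u 43 (by norm_num)) (u 29 (by norm_num))
      rfl rfl false false true false (by decide) (by decide) (by decide) (by decide) (fun q _ hq => ?_) (fun q _ hq => ?_)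
    · obtain ⟨h3, h13'⟩ := sl hq; rw [h3, h13']; norm_num
    · obtain ⟨h3, h13'⟩ := sl hq; rw [h3, h13']; norm_num

end Summit.BirchSwinnertonDyer.BirchSwinnertonDyer.Theorems.LinnikCensus
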